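import Literature.Barriers.Schanuel.NesterenkoModularScopeTransferToolkit
import Literature.Barriers.Schanuel.NesterenkoModularScopeProp36Loc
import Literature.NumberTheory.Transcendental.NesterenkoSymbolicPowers
import Literature.NumberTheory.Transcendental.NesterenkoEliminationProp411Cut
import Literature.RingTheory.KrullDimension.AffineCatenary
import Literature.RingTheory.MvPolynomial.HomogeneousDimension
import Mathlib.RingTheory.Lasker
import Literature.AlgebraicGeometry.Resolution.CohenMacaulayAvoidance
import Literature.AlgebraicGeometry.Resolution.CohenMacaulayCatenary
import Mathlib.RingTheory.Ideal.AssociatedPrime.Localization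
import Mathlib.RingTheory.Ideal.KrullsHeightTheorem
import Mathlib.RingTheory.RegularLocalRing.Polynomial
import Mathlib.RingTheory.Ideal.MinimalPrime.Localization
import Mathlib.Algebra.Module.LocalizedModule.Submodule
import HarnessLib

/-!
# Barrier (Schanuel) `NesterenkoModularScope`: towards Proposition 3.6 of LNM 1752 Ch. 10 (projectivised), II — unmixedness of the chain ideals

Proofs-only sibling of `NesterenkoModularScope*.lean`; no definitions, nothing asserted.

"Since `𝔞_{n+1}` is generated by `n + 2` polynomials, this means that `dim 𝔯 = m − n − 2`"
(LNM 1752 Ch. 10, proof of Prop. 3.6, p. 159): all associated primes of `𝔞_n = (E₀, …, E_n)` inside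
the prime `𝔭` have the expected dimension — there are no embedded ones. This is Macaulay's
unmixedness theorem in the regular (hence Cohen–Macaulay) local ring `R_𝔭`, for the images of
`E₀, …, E_n`, which form a regular sequence there because each `E_{i+1}` avoids the minimal primes
`⊆ 𝔭` of `(E₀, …, E_i)`. This file provides the commutative algebra: heights of primes over a
regular sequence, extension of avoiding sequences inside `𝔭`, and the unmixedness statement.

## References

* [NesterenkoPhilippon2001] Yu. V. Nesterenko, P. Philippon (eds.), *Introduction to Algebraic
  Independence Theory*, LNM 1752, Springer 2001, Ch. 10 §3, proof of Prop. 3.6 (p. 159).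
* [Matsumura1987] H. Matsumura, *Commutative Ring Theory*, CUP 1986, Thms. 17.4, 17.6
  (unmixedness in Cohen–Macaulay rings), 17.8.
-/

noncomputable section

open IsLocalRing RingTheory.Sequence Submodule
open scoped Pointwise

namespace Literature.Barriers.Schanuel

namespace Transfer

universe u

/-! ### Heights of primes over a regular sequence -/

section Height

variable {R : Type u} [CommRing R] [IsNoetherianRing R]

omit [IsNoetherianRing R] in
/-- The quotient module `R ⧸ (I • ⊤)` is the quotient ring `R ⧸ I` as an `R`-module. [folklore] -/
theorem ideal_smul_top_eq (I : Ideal R) : (I • (⊤ : Submodule R R)) = I := by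
  rw [smul_eq_mul, Ideal.mul_top]

/-- A minimal prime of `I` is an associated prime of the module `R ⧸ I`. [folklore] -/
theorem mem_associatedPrimes_quotient_of_mem_minimalPrimes {I p : Ideal R} (hp : p ∈ I.minimalPrimes) :
    p ∈ associatedPrimes R (R ⧸ I) := by
  have h := Module.associatedPrimes.minimalPrimes_annihilator_subset_associatedPrimes (R := R) (M := R ⧸ I)
  rw [Ideal.annihilator_quotient] at h
  exact h hp

/-- **A prime containing a (weakly) regular sequence has height at least its length.**
(Each `x_{i+1}`, being regular on `R/(x₁, …, xᵢ)`, lies in no minimal prime of `(x₁, …, xᵢ)`.)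
[cite: Matsumura1987, Thm. 17.4 (i)] -/
theorem length_le_height_of_isWeaklyRegular {rs : List R} (hrs : IsWeaklyRegular R rs) {P : Ideal R}
    [hP : P.IsPrime] (hle : Ideal.ofList rs ≤ P) : (rs.length : ℕ∞) ≤ P.height := by
  induction rs using List.reverseRecOn generalizing P with
  | nil => simp
  | append_singleton init x ih =>
    rw [isWeaklyRegular_append_iff] at hrs
    obtain ⟨hinit, hx⟩ := hrs
    have hinitP : Ideal.ofList init ≤ P :=
      le_trans (Ideal.span_mono fun y (hy : y ∈ init) =>
        show y ∈ {r | r ∈ init ++ [x]} from List.mem_append_left _ hy) hle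
    have hxP : x ∈ P := hle (Ideal.subset_span (by simp))
    -- a minimal prime `P₀ ≤ P` of `(init)`
    obtain ⟨P₀, hP₀, hP₀P⟩ := Ideal.exists_minimalPrimes_le hinitP
    haveI : P₀.IsPrime := hP₀.1.1
    have hih := ih hinit (P := P₀) hP₀.1.2
    -- `x ∉ P₀`: `x` is regular on `R/(init)` and `P₀` is associated to it
    have hxreg : IsSMulRegular (R ⧸ Ideal.ofList init) x := by
      have h1 := ((isWeaklyRegular_cons_iff _ x []).mp hx).1
      have heq : (Ideal.ofList init • (⊤ : Submodule R R)) = Ideal.ofList init := ideal_smul_top_eq _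
      let e : (R ⧸ Ideal.ofList init • (⊤ : Submodule R R)) ≃ₗ[R] (R ⧸ Ideal.ofList init) :=
        Submodule.quotEquivOfEq _ _ heq
      exact (e.isSMulRegular_congr x).mp h1
    have hxP₀ : x ∉ P₀ :=
      Literature.AlgebraicGeometry.Resolution.not_mem_of_isSMulRegular
        (mem_associatedPrimes_quotient_of_mem_minimalPrimes hP₀) hxreg
    have hlt : P₀ < P := lt_of_le_of_ne hP₀P fun h => hxP₀ (h ▸ hxP)
    have h2 := Ideal.height_add_one_le_of_lt_of_isPrime hlt
    calc ((init ++ [x]).length : ℕ∞) = init.length + 1 := by simp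
      _ ≤ P₀.height + 1 := add_le_add hih le_rfl
      _ ≤ P.height := h2

end Height

/-! ### Associated primes of `R ⧸ I` versus associated primes of `I` -/

section Bridge

variable {R : Type u} [CommRing R]

/-- The annihilator of the class of `x` in `R ⧸ I` is `(I : x)`. [folklore] -/
theorem colon_bot_mk_eq (I : Ideal R) (x : R) :
    Submodule.colon (⊥ : Submodule R (R ⧸ I)) {(Submodule.Quotient.mk x : R ⧸ I)} = I.colon {x} := by
  ext r
  rw [Submodule.mem_colon_singleton, Submodule.mem_bot, ← Submodule.Quotient.mk_smul,
    Submodule.Quotient.mk_eq_zero, Submodule.mem_colon_singleton]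

/-- The associated primes of the module `R ⧸ I` are the associated primes of the ideal `I`
(`Submodule.associatedPrimes`). [folklore] -/
theorem mem_associatedPrimes_quotient_iff {I P : Ideal R} :
    P ∈ associatedPrimes R (R ⧸ I) ↔ P ∈ I.associatedPrimes := by
  rw [AssociatedPrimes.mem_iff, IsAssociatedPrime, Submodule.isAssociatedPrime_def,
    Submodule.AssociatePrimes.mem_iff, Submodule.isAssociatedPrime_def]
  refine and_congr_right fun _ => ⟨?_, ?_⟩
  · rintro ⟨y, hy⟩
    obtain ⟨x, rfl⟩ := Submodule.Quotient.mk_surjective I y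
    exact ⟨x, by rw [hy, colon_bot_mk_eq]⟩
  · rintro ⟨x, hx⟩
    exact ⟨Submodule.Quotient.mk x, by rw [hx, colon_bot_mk_eq]⟩

/-- `I ≤ P` for an associated prime `P` of `R ⧸ I`. [folklore] -/
theorem le_of_mem_associatedPrimes_quotient {I P : Ideal R} (hP : P ∈ associatedPrimes R (R ⧸ I)) :
    I ≤ P := by
  have h := IsAssociatedPrime.annihilator_le (I := P) (M := R ⧸ I) hP
  rwa [Submodule.annihilator_top, Ideal.annihilator_quotient] at h

end Bridge

/-! ### Unmixedness over a Cohen–Macaulay local ring -/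

section LocalCM

open Literature.AlgebraicGeometry.Resolution

variable {B : Type u} [CommRing B] [IsLocalRing B] [IsNoetherianRing B]

/-- **Unmixedness theorem** (Macaulay, Cohen) in the form used here: if `E₁, …, E_k, Q₁, …, Q_l ∈ 𝔪`
is a `B`-regular sequence of total length `dim B` in the Noetherian local ring `(B, 𝔪)`, then
every associated prime of `B/(E₁, …, E_k)` is a minimal prime of `(E₁, …, E_k)` — the quotient has
no embedded primes. (Coheight of an associated prime `≥ l` by Stacks 0BK4, height of a smaller
minimal prime `≥ k`, and `height + coheight ≤ dim B = k + l`.)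
[cite: Matsumura1987, Thm. 17.6 with Thm. 17.4] -/
theorem minimalPrimes_of_mem_associatedPrimes_ofList {Es Q' : List B} (hEQ : IsRegular B (Es ++ Q'))
    (hm : ∀ x ∈ Es ++ Q', x ∈ maximalIdeal B)
    (hlen : ((Es ++ Q').length : WithBot ℕ∞) = ringKrullDim B) {P : Ideal B}
    (hP : P ∈ associatedPrimes B (B ⧸ Ideal.ofList Es)) : P ∈ (Ideal.ofList Es).minimalPrimes := by
  have hPprime : P.IsPrime := IsAssociatedPrime.isPrime hP
  have hw := hEQ.toIsWeaklyRegular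
  rw [isWeaklyRegular_append_iff] at hw
  obtain ⟨hEs, hQ'⟩ := hw
  -- `Q'` is a regular sequence on `B/(Es)`
  have hQ'w : IsWeaklyRegular (B ⧸ Ideal.ofList Es) Q' :=
    ((Submodule.quotEquivOfEq _ _ (ideal_smul_top_eq (Ideal.ofList Es))).isWeaklyRegular_congr Q').mp
      hQ'
  have hmQ' : ∀ x ∈ Q', x ∈ maximalIdeal B := fun x hx => hm x (List.mem_append_right _ hx)
  have hEsle : Ideal.ofList Es ≤ maximalIdeal B :=
    Ideal.span_le.mpr fun x hx => hm x (List.mem_append_left _ hx)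
  haveI : Nontrivial (B ⧸ Ideal.ofList Es) :=
    Ideal.Quotient.nontrivial_iff.mpr (ne_top_of_le_ne_top (maximalIdeal.isMaximal B).ne_top hEsle)
  have hQ'reg : IsRegular (B ⧸ Ideal.ofList Es) Q' :=
    IsRegular.of_isWeaklyRegular_of_mem_maximalIdeal _ hmQ' hQ'w
  -- coheight `≥ l`
  have h1 := length_le_coheight_of_mem_associatedPrimes hQ'reg hmQ' hP
  -- a minimal prime `P₀ ≤ P` of `(Es)`
  have hEsP : Ideal.ofList Es ≤ P := le_of_mem_associatedPrimes_quotient hP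
  obtain ⟨P₀, hP₀, hP₀P⟩ := Ideal.exists_minimalPrimes_le hEsP
  by_contra hPmin
  have hlt : P₀ < P := lt_of_le_of_ne hP₀P fun h => hPmin (h ▸ hP₀)
  haveI : P₀.IsPrime := hP₀.1.1
  have h2 : (Es.length : ℕ∞) ≤ P₀.height := length_le_height_of_isWeaklyRegular hEs hP₀.1.2
  have h3 := Ideal.height_add_one_le_of_lt_of_isPrime hlt
  have h4 := height_add_coheight_le_krullDim (⟨P, hPprime⟩ : PrimeSpectrum B)
  rw [← ringKrullDim, ← hlen, ← WithBot.coe_natCast, WithBot.coe_le_coe,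
    ← PrimeSpectrum.height_eq_orderHeight] at h4
  have hsum : (Es.length : ℕ∞) + 1 + Q'.length ≤ ((Es ++ Q').length : ℕ) :=
    calc (Es.length : ℕ∞) + 1 + Q'.length
        ≤ P.height + Order.coheight (⟨P, hPprime⟩ : PrimeSpectrum B) :=
          add_le_add ((add_le_add h2 le_rfl).trans h3) h1
      _ ≤ _ := h4
  have h5 : (Es.length + 1 + Q'.length : ℕ) ≤ (Es ++ Q').length := by exact_mod_cast hsum
  rw [List.length_append] at h5
  omega

/-- Appending to an avoiding sequence an element outside the minimal primes of the ideal it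
generates gives an avoiding sequence. [folklore] -/
theorem avoidsMinimalPrimes_append_singleton {R : Type u} [CommRing R] {C : List R} {y : R}
    (hav : AvoidsMinimalPrimes C) (hy : ∀ P ∈ (Ideal.ofList C).minimalPrimes, y ∉ P) :
    AvoidsMinimalPrimes (C ++ [y]) := by
  intro L₁ q L₂ hdec P hP
  rcases List.append_eq_append_iff.mp hdec with ⟨a', hL₁, h2⟩ | ⟨c', hC, h2⟩
  · cases a' with
    | nil =>
      simp only [List.nil_append, List.cons.injEq] at h2
      obtain ⟨rfl, -⟩ := h2
      rw [List.append_nil] at hL₁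
      subst hL₁
      exact hy P hP
    | cons z a'' => simp at h2
  · cases c' with
    | nil =>
      simp only [List.nil_append, List.cons.injEq] at h2
      obtain ⟨rfl, -⟩ := h2
      rw [List.append_nil] at hC
      subst hC
      exact hy P hP
    | cons z c'' =>
      simp only [List.cons_append, List.cons.injEq] at h2
      obtain ⟨hqz, -⟩ := h2
      rw [hqz]
      exact hav L₁ z c'' hC P hP

/-- **Extending an avoiding sequence in `𝔪` to length `dim B`**: while the sequence is shorter
than `height 𝔪`, the maximal ideal is not minimal over it (Krull's height theorem), so prime
avoidance provides a next element of `𝔪` outside all its minimal primes. [folklore] -/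
theorem exists_append_avoidsMinimalPrimes {C : List B} (hC : ∀ x ∈ C, x ∈ maximalIdeal B)
    (hav : AvoidsMinimalPrimes C) {d : ℕ} (hd : (maximalIdeal B).height = d) (hle : C.length ≤ d) :
    ∃ Q' : List B, (∀ x ∈ Q', x ∈ maximalIdeal B) ∧ AvoidsMinimalPrimes (C ++ Q') ∧
      (C ++ Q').length = d := by
  obtain ⟨k, hk⟩ : ∃ k, d = C.length + k := ⟨d - C.length, by omega⟩
  induction k generalizing C with
  | zero => exact ⟨[], by simp, by simpa using hav, by simp [hk]⟩
  | succ k ih =>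
    classical
    have hfin := Ideal.finite_minimalPrimes_of_isNoetherianRing B (Ideal.ofList C)
    -- `𝔪` is not a minimal prime of `(C)`
    have hnotmin : maximalIdeal B ∉ (Ideal.ofList C).minimalPrimes := by
      intro hmin
      have h1 := Ideal.height_le_card_of_mem_minimalPrimes_span_finset (s := C.toFinset)
        (p := maximalIdeal B) (by rwa [List.coe_toFinset])
      have h2 := List.toFinset_card_le C
      rw [hd] at h1
      have h3 : d ≤ C.toFinset.card := by exact_mod_cast h1
      omega
    -- hence `𝔪 ⊄ ⋃ minimal primes`
    have hnot : ¬ ((maximalIdeal B : Set B) ⊆ ⋃ P ∈ (hfin.toFinset : Set (Ideal B)), (P : Set B)) := by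
      intro hsub
      obtain ⟨P, hP, hle'⟩ := (Ideal.subset_union_prime (⊥ : Ideal B) (⊥ : Ideal B) (f := id)
        (fun P hP _ _ => (hfin.mem_toFinset.mp hP).1.1)).mp hsub
      have hPmin := hfin.mem_toFinset.mp hP
      have hPeq : P = maximalIdeal B :=
        ((maximalIdeal.isMaximal B).eq_of_le hPmin.1.1.ne_top hle').symm
      exact hnotmin (hPeq ▸ hPmin)
    obtain ⟨y, hy𝔪, hy⟩ := Set.not_subset.mp hnot
    have hy' : ∀ P ∈ (Ideal.ofList C).minimalPrimes, y ∉ P := fun P hP hyP =>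
      hy (Set.mem_iUnion₂.mpr ⟨P, hfin.mem_toFinset.mpr hP, hyP⟩)
    have hC' : ∀ x ∈ C ++ [y], x ∈ maximalIdeal B := by
      intro x hx
      rcases List.mem_append.mp hx with h | h
      · exact hC x h
      · rw [List.mem_singleton] at h; exact h ▸ hy𝔪
    obtain ⟨Q'', hQ''m, havQ, hlenQ⟩ := ih hC' (avoidsMinimalPrimes_append_singleton hav hy')
      (by simp; omega) (by simp; omega)
    refine ⟨y :: Q'', ?_, by simpa using havQ, by simpa using hlenQ⟩
    intro x hx
    rcases List.mem_cons.mp hx with rfl | h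
    · exact hy𝔪
    · exact hQ''m x h

end LocalCM

/-! ### Transport to the localisation at `𝔭` -/

section AtPrime

open Literature.AlgebraicGeometry.Resolution

variable {R : Type u} [CommRing R] (𝔭 : Ideal R) [h𝔭 : 𝔭.IsPrime]

/-- The avoidance hypothesis relative to `𝔭` — each `Q_{l+1}` lies outside every minimal prime
`𝔭' ⊆ 𝔭` of `(Q₁, …, Q_l)` — passes to the localisation `R_𝔭`. [folklore] -/
theorem avoidsMinimalPrimes_map_atPrime {Q : List R}
    (hav : ∀ (L₁ : List R) (q : R) (L₂ : List R), Q = L₁ ++ q :: L₂ →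
      ∀ 𝔭' ∈ (Ideal.ofList L₁).minimalPrimes, 𝔭' ≤ 𝔭 → q ∉ 𝔭') :
    AvoidsMinimalPrimes (Q.map (algebraMap R (Localization.AtPrime 𝔭))) := by
  intro M₁ x M₂ hdec 𝔓 h𝔓 hx
  set f := algebraMap R (Localization.AtPrime 𝔭) with hf
  obtain ⟨L₁, L, rfl, hL₁, hL⟩ := List.map_eq_append_iff.mp hdec
  obtain ⟨q, L₂, rfl, hq, hL₂⟩ := List.map_eq_cons_iff.mp hL
  have h𝔓p : 𝔓.IsPrime := h𝔓.1.1
  rw [← hL₁, ← Ideal.map_ofList, IsLocalization.minimalPrimes_map 𝔭.primeCompl] at h𝔓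
  have h1 : 𝔓.under R ∈ (Ideal.ofList L₁).minimalPrimes := h𝔓
  have hdisj := ((IsLocalization.isPrime_iff_isPrime_disjoint 𝔭.primeCompl (Localization.AtPrime 𝔭) 𝔓).mp
    h𝔓p).2
  have hle : 𝔓.under R ≤ 𝔭 := fun y hy => by
    by_contra hy𝔭
    exact Set.disjoint_left.mp hdisj (show y ∈ (𝔭.primeCompl : Set _) from hy𝔭) hy
  refine hav L₁ q L₂ rfl _ h1 hle ?_
  rw [Ideal.under_def, Ideal.mem_comap, ← hf, hq]
  exact hx

/-- **Unmixedness of `(E₁, …, E_k)` at `𝔭`** (for a regular ring `R`, e.g. a polynomial ring over a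
field): if `E₁, …, E_k ∈ 𝔭` and each `E_{l+1}` lies outside every minimal prime `𝔭' ⊆ 𝔭` of
`(E₁, …, E_l)`, then every associated prime `P ⊆ 𝔭` of `R/(E₁, …, E_k)` is a minimal prime of
`(E₁, …, E_k)`, of height exactly `k`. Proof: `R_𝔭` is a regular, hence Cohen–Macaulay, local ring;
the `E_i` start a maximal regular sequence of `R_𝔭` (prime avoidance), so the unmixedness theorem
applies in `R_𝔭`, and associated/minimal primes inside `𝔭` correspond under localisation.
[cite: Matsumura1987, Thm. 17.6, Thm. 17.8] -/
theorem minimalPrimes_of_mem_associatedPrimes_of_le [IsRegularRing R] {Es : List R}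
    (hEs : ∀ x ∈ Es, x ∈ 𝔭)
    (hav : ∀ (L₁ : List R) (q : R) (L₂ : List R), Es = L₁ ++ q :: L₂ →
      ∀ 𝔭' ∈ (Ideal.ofList L₁).minimalPrimes, 𝔭' ≤ 𝔭 → q ∉ 𝔭')
    {P : Ideal R} (hP : P ∈ associatedPrimes R (R ⧸ Ideal.ofList Es)) (hP𝔭 : P ≤ 𝔭) :
    P ∈ (Ideal.ofList Es).minimalPrimes ∧ P.height = Es.length := by
  have hPprime : P.IsPrime := IsAssociatedPrime.isPrime hP
  set B := Localization.AtPrime 𝔭 with hB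
  set f := algebraMap R B with hf
  -- `B` is a regular local ring, hence Cohen–Macaulay
  obtain ⟨rs, hrs, hmem, hlen⟩ := exists_isRegular_length_eq_ringKrullDim B
  have hmapm : ∀ (L : List R), (∀ x ∈ L, x ∈ 𝔭) → ∀ x ∈ L.map f, x ∈ maximalIdeal B := by
    intro L hL x hx
    obtain ⟨q', hq', rfl⟩ := List.mem_map.mp hx
    exact (IsLocalization.AtPrime.to_map_mem_maximal_iff B 𝔭 q').mpr (hL q' hq')
  have hEsm := hmapm Es hEs
  have havB := avoidsMinimalPrimes_map_atPrime 𝔭 hav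
  have hreg : IsRegular B (Es.map f) := isRegular_of_forall_notMem_minimalPrimes hrs hmem hlen hEsm havB
  -- `dim B = height 𝔭 = height 𝔪_B =: d`
  have hdimB : ringKrullDim B = 𝔭.height := IsLocalization.AtPrime.ringKrullDim_eq_height 𝔭 B
  have h𝔪 : (maximalIdeal B).height = 𝔭.height := by
    have h := IsLocalRing.maximalIdeal_height_eq_ringKrullDim (R := B)
    rw [hdimB] at h
    exact_mod_cast h
  obtain ⟨d, hd⟩ := ENat.ne_top_iff_exists.mp (Ideal.height_ne_top h𝔭.ne_top)
  have hd' : 𝔭.height = d := hd.symm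
  -- `k ≤ d`
  have hlenle : Es.length ≤ d := by
    have h1 := length_le_height_of_isWeaklyRegular hreg.toIsWeaklyRegular (P := maximalIdeal B)
      (Ideal.span_le.mpr fun x hx => hEsm x hx)
    rw [List.length_map, h𝔪, hd'] at h1
    exact_mod_cast h1
  -- extend to a maximal regular sequence
  obtain ⟨Q', hQ'm, havQ, hlenQ⟩ :=
    exists_append_avoidsMinimalPrimes hEsm havB (by rw [h𝔪, hd']) (by simpa using hlenle)
  have hmQ : ∀ x ∈ Es.map f ++ Q', x ∈ maximalIdeal B := by
    intro x hx
    rcases List.mem_append.mp hx with h | h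
    · exact hEsm x h
    · exact hQ'm x h
  have hregQ : IsRegular B (Es.map f ++ Q') := isRegular_of_forall_notMem_minimalPrimes hrs hmem hlen hmQ havQ
  have hlenQ' : ((Es.map f ++ Q').length : WithBot ℕ∞) = ringKrullDim B := by
    rw [hlenQ, hdimB, hd']; rfl
  -- transport `P` to `B`
  set P' := P.map f with hP'
  have hdisj : Disjoint (𝔭.primeCompl : Set R) P := by
    refine Set.disjoint_left.mpr fun y hy hyP => hy (hP𝔭 hyP)
  have hunder : P'.under R = P := IsLocalization.under_map_of_isPrime_disjoint 𝔭.primeCompl B hPprime hdisj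
  have hcomap : P'.comap (algebraMap R B) ∈ associatedPrimes R (R ⧸ Ideal.ofList Es) := by
    rw [← Ideal.under_def, hunder]; exact hP
  have key := Module.associatedPrimes.mem_associatedPrimes_of_comap_mem_associatedPrimes_of_isLocalizedModule
    𝔭.primeCompl ((Ideal.ofList Es).toLocalizedQuotient' B 𝔭.primeCompl (Algebra.linearMap R B)) P' hcomap
  have hloc : (Ideal.ofList Es).localized' B 𝔭.primeCompl (Algebra.linearMap R B) =
      ((Ideal.ofList (Es.map f) : Ideal B) : Submodule B B) := by
    rw [Submodule.localized'_eq_span, Algebra.coe_linearMap, ← Ideal.map_ofList]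
    rfl
  have hP'ass : P' ∈ associatedPrimes B (B ⧸ Ideal.ofList (Es.map f)) := by
    rw [← LinearEquiv.AssociatedPrimes.eq (Submodule.quotEquivOfEq _ _ hloc)]
    exact key
  -- unmixedness in `B`
  have hmin' := minimalPrimes_of_mem_associatedPrimes_ofList hregQ hmQ hlenQ' hP'ass
  rw [← Ideal.map_ofList, IsLocalization.minimalPrimes_map 𝔭.primeCompl] at hmin'
  have hmin : P ∈ (Ideal.ofList Es).minimalPrimes := by
    have h : P'.under R ∈ (Ideal.ofList Es).minimalPrimes := hmin'
    rwa [hunder] at h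
  refine ⟨hmin, le_antisymm ?_ ?_⟩
  · classical
    have h1 := Ideal.height_le_card_of_mem_minimalPrimes_span_finset (s := Es.toFinset) (p := P)
      (by rwa [List.coe_toFinset])
    exact h1.trans (by exact_mod_cast List.toFinset_card_le Es)
  · haveI : P'.IsPrime := IsLocalization.isPrime_of_isPrime_disjoint 𝔭.primeCompl B P hPprime hdisj
    have h1 := length_le_height_of_isWeaklyRegular hreg.toIsWeaklyRegular (P := P')
      (by rw [← Ideal.map_ofList]; exact Ideal.map_mono (le_of_mem_associatedPrimes_quotient hP))
    have h2 : P.height = P'.height := by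
      rw [← IsLocalization.height_under 𝔭.primeCompl (A := B) P', hunder]
    rwa [List.length_map, ← h2] at h1

end AtPrime

/-! ### The component at `𝔭` through a minimal primary decomposition -/

section Component

variable {R : Type u} [CommRing R] {𝔭 : Ideal R} (h𝔭 : 𝔭.IsPrime)

/-- The sub-family of a minimal primary decomposition of `I` consisting of the components whose
radical lies inside `𝔭` is a minimal primary decomposition of the component `I R_𝔭 ∩ R`.
[folklore] -/
theorem exists_isMinimalPrimaryDecomposition_locP {I : Ideal R} {t : Finset (Ideal R)}
    (ht : Submodule.IsMinimalPrimaryDecomposition I t) :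
    ∃ t' : Finset (Ideal R), t' ⊆ t ∧ Submodule.IsMinimalPrimaryDecomposition (locP 𝔭 h𝔭 I) t' ∧
      ∀ Q, Q ∈ t' ↔ Q ∈ t ∧ Q.radical ≤ 𝔭 := by
  classical
  refine ⟨t.filter fun Q => Q.radical ≤ 𝔭, Finset.filter_subset _ _, ⟨?_, ?_, ?_, ?_⟩,
    fun Q => Finset.mem_filter⟩
  · rw [locP_eq_inf_filter h𝔭 t id (fun i hi => ht.primary hi) ht.inf_eq]
    rfl
  · exact fun Q hQ => ht.primary (Finset.mem_filter.mp hQ).1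
  · exact ht.distinct.mono (Finset.coe_subset.mpr (Finset.filter_subset _ _))
  · intro Q hQ hle
    exact ht.minimal (Finset.mem_filter.mp hQ).1
      ((Finset.inf_mono (Finset.erase_subset_erase Q (Finset.filter_subset _ t))).trans hle)

/-- The associated primes of the component `I R_𝔭 ∩ R` (Noetherian `R`): the associated primes
`P ⊆ 𝔭` of `I`. [folklore] -/
theorem mem_associatedPrimes_locP_iff [IsNoetherianRing R] {I P : Ideal R} :
    P ∈ (locP 𝔭 h𝔭 I).associatedPrimes ↔ P ∈ I.associatedPrimes ∧ P ≤ 𝔭 := by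
  classical
  obtain ⟨t, ht⟩ := (Submodule.isLasker R R).exists_isMinimalPrimaryDecomposition I
  obtain ⟨t', -, ht', hmem⟩ := exists_isMinimalPrimaryDecomposition_locP h𝔭 ht
  rw [← ht'.image_radical_eq_associated_primes, ← ht.image_radical_eq_associated_primes]
  constructor
  · rintro ⟨Q, hQ, rfl⟩
    obtain ⟨hQt, hrad⟩ := (hmem Q).mp hQ
    refine ⟨⟨Q, hQt, rfl⟩, ?_⟩
    simpa only [Submodule.colon_univ] using hrad
  · rintro ⟨⟨Q, hQt, rfl⟩, hrad⟩
    refine ⟨Q, (hmem Q).mpr ⟨hQt, ?_⟩, rfl⟩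
    simpa only [Submodule.colon_univ] using hrad

end Component

/-! ### The chain ideals in `ℚ[x₀, …, x_m]` -/

section Poly

open MvPolynomial Literature.NumberTheory.Transcendental Literature.NumberTheory.Transcendental.Nesterenko

variable {m : ℕ}

/-- **The dimension formula** in `ℚ[x₀, …, x_m]`: a prime of height `h` has `h ≤ m + 1` and
`dim ℚ[x̲]/P = m + 1 − h` (affine domains are catenary). [cite: Matsumura1987, Thm 5.6] -/
theorem ringKrullDim_quotient_eq_of_height_eq {P : Ideal (Rx m)} [hP : P.IsPrime] {h : ℕ}
    (hh : P.height = h) : h ≤ m + 1 ∧ ringKrullDim (Rx m ⧸ P) = (m + 1 - h : ℕ) := by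
  have hcat := Literature.RingTheory.KrullDimension.ringKrullDim_quotient_add_height (F := ℚ) P
  rw [Literature.RingTheory.MvPolynomial.ringKrullDim_mvPolynomial_fin (K := ℚ) (m + 1), hh] at hcat
  obtain ⟨n, hn, -⟩ :=
    Literature.RingTheory.MvPolynomial.exists_nat_ringKrullDim_quotient_eq (K := ℚ) hP.ne_top
  rw [hn] at hcat
  have h' : ((n + h : ℕ) : WithBot ℕ∞) = ((m + 1 : ℕ) : WithBot ℕ∞) := by
    push_cast at hcat ⊢
    exact hcat
  have hnh : n + h = m + 1 := by exact_mod_cast h'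
  refine ⟨by omega, ?_⟩
  obtain rfl : n = m + 1 - h := by omega
  exact hn

attribute [local instance] MvPolynomial.gradedAlgebra

variable {𝔭 : Ideal (Rx m)} {Es : List (Rx m)}

/-- **The chain ideals are unmixed** ("since `𝔞_{n+1}` is generated by `n + 2` polynomials, this
means that `dim 𝔯 = m − n − 2`", LNM 1752 Ch. 10, proof of Prop. 3.6, p. 159). Let `𝔭` be a prime
of `ℚ[x₀, …, x_m]` and `E₁, …, E_k ∈ 𝔭` such that each `E_{l+1}` lies outside every minimal prime
`𝔭' ⊆ 𝔭` of `(E₁, …, E_l)`. Then every associated prime `P ⊆ 𝔭` of `(E₁, …, E_k)` is a minimal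
prime of it, of height `k` and dimension `dim ℚ[x̲]/P = m + 1 − k`; consequently the component
`𝔲 = (E₁, …, E_k) ℚ[x̲]_𝔭 ∩ ℚ[x̲]` is unmixed with `dim 𝔲 = m − k` (i.e. `IsUnmixedOfRank 𝔲 (m + 1 − k)`)
and its associated primes are exactly the minimal primes `⊆ 𝔭` of `(E₁, …, E_k)`.
[cite: NesterenkoPhilippon2001, Ch. 10, proof of Prop. 3.6 (p. 159); Matsumura1987, Thm. 17.6] -/
theorem mem_minimalPrimes_of_mem_associatedPrimes_ofList (h𝔭 : 𝔭.IsPrime) (hEs : ∀ x ∈ Es, x ∈ 𝔭)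
    (hav : ∀ (L₁ : List (Rx m)) (q : Rx m) (L₂ : List (Rx m)), Es = L₁ ++ q :: L₂ →
      ∀ 𝔭' ∈ (Ideal.ofList L₁).minimalPrimes, 𝔭' ≤ 𝔭 → q ∉ 𝔭')
    {P : Ideal (Rx m)} (hP : P ∈ (Ideal.ofList Es).associatedPrimes) (hP𝔭 : P ≤ 𝔭) :
    P ∈ (Ideal.ofList Es).minimalPrimes ∧ P.height = Es.length ∧ Es.length ≤ m + 1 ∧
      ringKrullDim (Rx m ⧸ P) = (m + 1 - Es.length : ℕ) := by
  haveI := h𝔭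
  obtain ⟨hmin, hh⟩ := minimalPrimes_of_mem_associatedPrimes_of_le 𝔭 hEs hav
    (mem_associatedPrimes_quotient_iff.mpr hP) hP𝔭
  haveI : P.IsPrime := hmin.1.1
  exact ⟨hmin, hh, ringKrullDim_quotient_eq_of_height_eq hh⟩

/-- The component `𝔲 = (E₁, …, E_k) ℚ[x̲]_𝔭 ∩ ℚ[x̲]` of the chain ideal is unmixed of rank
`m + 1 − k`, and its associated primes are the minimal primes `⊆ 𝔭` of `(E₁, …, E_k)`.
[cite: NesterenkoPhilippon2001, Ch. 10, proof of Prop. 3.6 (p. 159)] -/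
theorem isUnmixedOfRank_locP_ofList (h𝔭 : 𝔭.IsPrime) (hEs : ∀ x ∈ Es, x ∈ 𝔭)
    (hav : ∀ (L₁ : List (Rx m)) (q : Rx m) (L₂ : List (Rx m)), Es = L₁ ++ q :: L₂ →
      ∀ 𝔭' ∈ (Ideal.ofList L₁).minimalPrimes, 𝔭' ≤ 𝔭 → q ∉ 𝔭') :
    IsUnmixedOfRank (locP 𝔭 h𝔭 (Ideal.ofList Es)) (m + 1 - Es.length) ∧
      ∀ P : Ideal (Rx m), P ∈ (locP 𝔭 h𝔭 (Ideal.ofList Es)).associatedPrimes ↔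
        P ∈ (Ideal.ofList Es).minimalPrimes ∧ P ≤ 𝔭 := by
  have hass : ∀ P : Ideal (Rx m), P ∈ (locP 𝔭 h𝔭 (Ideal.ofList Es)).associatedPrimes ↔
      P ∈ (Ideal.ofList Es).minimalPrimes ∧ P ≤ 𝔭 := by
    intro P
    rw [mem_associatedPrimes_locP_iff h𝔭]
    constructor
    · rintro ⟨hP, hP𝔭⟩
      exact ⟨(mem_minimalPrimes_of_mem_associatedPrimes_ofList h𝔭 hEs hav hP hP𝔭).1, hP𝔭⟩
    · rintro ⟨hP, hP𝔭⟩
      exact ⟨mem_associatedPrimes_quotient_iff.mp (mem_associatedPrimes_quotient_of_mem_minimalPrimes hP),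
        hP𝔭⟩
  refine ⟨⟨?_, fun P hP => ?_⟩, hass⟩
  · exact ne_top_of_le_ne_top h𝔭.ne_top (locP_le h𝔭 _ (Ideal.span_le.mpr fun x hx => hEs x hx))
  · rw [mem_associatedPrimes_locP_iff h𝔭] at hP
    exact (mem_minimalPrimes_of_mem_associatedPrimes_ofList h𝔭 hEs hav hP.1 hP.2).2.2.2

/-- The component of a homogeneous ideal at a prime is homogeneous (through a primary
decomposition by homogeneous primary ideals — the homogeneous cores of the components of any
primary decomposition). [folklore] -/
theorem isHomogeneous_locP (h𝔭 : 𝔭.IsPrime) {I : Ideal (Rx m)}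
    (hI : I.IsHomogeneous (homogeneousSubmodule (Fin (m + 1)) ℚ)) :
    (locP 𝔭 h𝔭 I).IsHomogeneous (homogeneousSubmodule (Fin (m + 1)) ℚ) := by
  classical
  obtain ⟨t, ht⟩ := (Submodule.isLasker (Rx m) (Rx m)).exists_isMinimalPrimaryDecomposition I
  set core : Ideal (Rx m) → Ideal (Rx m) := fun Q =>
    (Q.homogeneousCore (homogeneousSubmodule (Fin (m + 1)) ℚ)).toIdeal with hcore
  have hprim : ∀ Q ∈ t, (core Q).IsPrimary := fun Q hQ => isPrimary_homogeneousCore (ht.primary hQ)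
  have hinf : t.inf core = I := by
    refine le_antisymm ?_ (Finset.le_inf fun Q hQ => ?_)
    · calc t.inf core ≤ t.inf id :=
            Finset.le_inf fun Q hQ => (Finset.inf_le hQ).trans (Ideal.toIdeal_homogeneousCore_le _ Q)
        _ = I := ht.inf_eq
    · rw [← hI.toIdeal_homogeneousCore_eq_self]
      exact Ideal.homogeneousCore_mono _ (ht.inf_eq ▸ Finset.inf_le (f := id) hQ)
  rw [locP_eq_inf_filter h𝔭 t core hprim hinf]
  exact Literature.NumberTheory.Transcendental.Nesterenko.isHomogeneous_finset_inf' core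
    fun Q _ => (Q.homogeneousCore (homogeneousSubmodule (Fin (m + 1)) ℚ)).isHomogeneous

end Poly



end Transfer

end Literature.Barriers.Schanuel

end
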